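import Summits.QuantumFields.YangMills.Theorems.UnitScaleTiltFluctuationComparisonRegPrLevelCauchyMinT
import HarnessLib

/-!
# Crux-idea sketch (ideator 2, gen 10; card C7 `term-function-sink`, finding F-C7-2 KING-SLACK AT THE GLOBAL LEVEL) for
# `FluctuationComparisonRegPr[L]` (stmt-QuantumFields-19201 / -19935), line v5j′ STUB 3″′ `stub_pintDecompTwoRunMinFam`.

CONTEXT. OWNER RULING g20-№7 §8 (2026-08-27T09:18Z): per-polymer locality of the term function is NOT load-bearing in R3's `closes`; STUB 3″′ stays as
registered and its (C)-content is served as ONE inequality per `(K, n)`, `GlobalSupRateT (dataOfV3 p π_blk) b₀ p₀ a C` (gen-9 sketch `Sketch_ideator2_g9.lean` §4,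
restated verbatim in §1 below so that this file is self-contained).  The sibling's card 9 (`flat-kernel-taylor-port`, F-idea1-g9-1) observes that the only
printed two-cut-off comparison ([King1986] Thm 3.4 (3.9) p.656) is not slack-free: it carries an additive `(L^kε)^σ ↦ θ(n)^σ`, σ = 7, and offers the owner
three typings of the (C) row: W0 (registered: pure rate, every height `n ≤ K`), W1 (rate + slack), W2 (pure rate at the window `n = ⌊K/m⌋` only).

THIS FILE types the three options AT THE GLOBAL LEVEL (the level the ruling says is served) and proves the two bookkeeping implications between them:
  §1 `GlobalSupRateT` (W0, verbatim), `GlobalSupSlackT … σ` (W1), `GlobalSupRateWindowT … m` (W2′);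
  §2 `globalSupSlackT_of_rate` (W0 ⇒ W1: the slack row is WEAKER, nothing proved for W0 is lost) and
     `globalSupRateWindowT_of_slack` (W1 + the absorption inequality `θ(⌊K/m⌋)^σ ≤ θ(⌊K/m⌋)²·L^{−a(K−⌊K/m⌋)}` at every `K` ⇒ W2′ with constant `2C`).
The absorption inequality is where the exponents meet (prose, F-C7-2 in the card): `θ(n)² = γL^{−n}·p(g_n)²` (`θBal`, T3UnitScaleTilt §4), so at `n = ⌊K/m⌋`
absorption holds for large `K` iff `a(m−1) < (σ−2)/2` (with the in-tree quarter-power bound `θBal_le_const_mul_sqrt_coupling` only `(σ−2)/4`), while the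
landed consumer `polymerCauchyAtT_of_twoRunMinT` needs `min(a,1)·(m−1) > τ` with `τ = 3` AS TYPED (it bounds `θ(⌊K/m⌋)²` by the K-uniform `Θ²`, lines
171/231/249), `τ = 5/2` with the quarter-power bound, `τ = 2+δ` with a sharp `g·p(g) ≤ C_δ g^{1−δ}`; both at once iff `σ > 2τ + 2` — and the REGISTERED stub binds
`∃ a` BEFORE `F, γ` and contains no `m` at all, so an `m`-dependent exponent (which W2′ needs for large `m`, and `closes` takes `m = max(m₁, m₂, 1)` with `m₁`
from stmt-19200) is not available: under W0 only all-order mechanisms can discharge 3″′; finite-order (King-type, σ < ∞) lines need W1.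
WHAT THIS IS NOT: no estimate is asserted or proved; all three rows are hypothesis schemas; nothing registered changes (count-neutral design remark for the owner).
References: C. King, CMP 102 (1986) 649–677 [King1986] (Thm 3.4 (3.9) p.656, Prop. 3.9 p.665); T. Bałaban, CMP 102 (1985) 255–275 [Balaban1985UV3] ((7) p.257, (46) p.267).
-/

noncomputable section

open MeasureTheory Filter Topology
open Literature.MathematicalPhysics.QuantumFieldTheory.Balaban1983to89
open Literature.MathematicalPhysics.QuantumFieldTheory.Balaban1983to89.T3ContinuumYM3Torus
open Literature.MathematicalPhysics.QuantumFieldTheory.Balaban1983to89.T3LevelShift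
open Literature.MathematicalPhysics.QuantumFieldTheory.Balaban1983to89.T3UnitScaleTilt
open Literature.MathematicalPhysics.QuantumFieldTheory.Balaban1983to89.T3AlphaInputsAC
open Literature.MathematicalPhysics.QuantumFieldTheory.Balaban1983to89.T3AlphaPolymerSocket
open Literature.MathematicalPhysics.QuantumFieldTheory.Balaban1983to89.T3AlphaInputsACTwoRunLevel

namespace Summit.QuantumFields.YangMills.Cruxes.FluctuationComparisonRegPr.Ideate2Slack

variable {F : T3Family} {γ : ℝ}
variable (D : AlphaDataT3 F γ)

/-! ## §1 The three typings of the global two-run row -/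

/-- **W0 — THE GLOBAL TWO-RUN BOUND AT RELATIVE RATE `L^{−a·k}`, EVERY HEIGHT** (verbatim `Ideate2Sink.GlobalSupRateT` of the gen-9 sketch; hypothesis
schema, never asserted): on the `θ(n)`-window, `|PintH (K+1) n V − PintH K n V − c K n| ≤ C·θ(n)²·#Site(F.P n)·L^{−a(K−n)}` for ALL `n ≤ K`.
UNPRINTED for non-abelian d = 3; [King1986] Prop. 3.9 p.665 is the abelian-Higgs analogue. [cite: King1986, Prop. 3.9 (3.73)-(3.75) p.665] -/
def GlobalSupRateT (b₀ p₀ a C : ℝ) : Prop :=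
  ∃ c : ℕ → ℕ → ℝ, ∀ (K n : ℕ), n ≤ K → ∀ V : GaugeField (F.P n) 0 (Matrix.specialUnitaryGroup (Fin 2) ℂ), PlaqSmall (θBal F.L γ b₀ p₀ n) V →
    |D.PintH (K + 1) n V - D.PintH K n V - c K n| ≤
      C * θBal F.L γ b₀ p₀ n ^ 2 * (Fintype.card (Site (F.P n) 0) : ℝ) * (((F.L : ℝ) ^ (K - n))⁻¹) ^ a

/-- **W1 — THE GLOBAL TWO-RUN BOUND WITH KING'S ADDITIVE SLACK `θ(n)^σ`** (hypothesis schema, never asserted): on the `θ(n)`-window,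
`|PintH (K+1) n V − PintH K n V − c K n| ≤ C·(θ(n)²·L^{−a(K−n)} + θ(n)^σ)·#Site(F.P n)` for all `n ≤ K` — the global form of the sibling's
`PolymerCauchyMinAtTSlack` (card 9); [King1986] Thm 3.4 (3.9) p.656 `C(L^{−γk}(L^kε)^{−β} + (L^kε)^σ)|T|` is its printed abelian shape, σ = 7 there.
[cite: King1986, Thm 3.4 (3.9) p.656] -/
def GlobalSupSlackT (b₀ p₀ a : ℝ) (σ : ℕ) (C : ℝ) : Prop :=
  ∃ c : ℕ → ℕ → ℝ, ∀ (K n : ℕ), n ≤ K → ∀ V : GaugeField (F.P n) 0 (Matrix.specialUnitaryGroup (Fin 2) ℂ), PlaqSmall (θBal F.L γ b₀ p₀ n) V →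
    |D.PintH (K + 1) n V - D.PintH K n V - c K n| ≤
      C * (θBal F.L γ b₀ p₀ n ^ 2 * (((F.L : ℝ) ^ (K - n))⁻¹) ^ a + θBal F.L γ b₀ p₀ n ^ σ) * (Fintype.card (Site (F.P n) 0) : ℝ)

/-- **W2′ — THE GLOBAL TWO-RUN BOUND AT RATE `a`, AT THE WINDOW HEIGHT `n = ⌊K/m⌋` ONLY** (hypothesis schema, never asserted): the W0 inequality at the
single height the route's consumer reads (`CauchyAtHeights D b₀ p₀ m`, `closes` with `n = K/m`), for one `m`. [cite: King1986, Thm 3.4 (3.12)-(3.13) p.657] -/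
def GlobalSupRateWindowT (b₀ p₀ a C : ℝ) (m : ℕ) : Prop :=
  ∃ c : ℕ → ℕ → ℝ, ∀ (K : ℕ), ∀ V : GaugeField (F.P (K / m)) 0 (Matrix.specialUnitaryGroup (Fin 2) ℂ), PlaqSmall (θBal F.L γ b₀ p₀ (K / m)) V →
    |D.PintH (K + 1) (K / m) V - D.PintH K (K / m) V - c K (K / m)| ≤
      C * θBal F.L γ b₀ p₀ (K / m) ^ 2 * (Fintype.card (Site (F.P (K / m)) 0) : ℝ) * (((F.L : ℝ) ^ (K - K / m))⁻¹) ^ a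

/-! ## §2 The two bookkeeping implications -/

/-- **W0 ⇒ W1**: the slack row is weaker (for `C ≥ 0` and non-negative thresholds) — re-typing the (C) row with the slack loses nothing already proved
for the pure row. [cite: King1986, Thm 3.4 (3.9) p.656] -/
theorem globalSupSlackT_of_rate {b₀ p₀ a C : ℝ} (σ : ℕ) (hC : 0 ≤ C) (hθ : ∀ n, 0 ≤ θBal F.L γ b₀ p₀ n)
    (h : GlobalSupRateT D b₀ p₀ a C) : GlobalSupSlackT D b₀ p₀ a σ C := by
  obtain ⟨c, hc⟩ := h
  refine ⟨c, fun K n hn V hV => (hc K n hn V hV).trans ?_⟩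
  have hN : (0 : ℝ) ≤ (Fintype.card (Site (F.P n) 0) : ℝ) := Nat.cast_nonneg _
  have hs : 0 ≤ θBal F.L γ b₀ p₀ n ^ σ := pow_nonneg (hθ n) σ
  have hle : θBal F.L γ b₀ p₀ n ^ 2 * (((F.L : ℝ) ^ (K - n))⁻¹) ^ a ≤
      θBal F.L γ b₀ p₀ n ^ 2 * (((F.L : ℝ) ^ (K - n))⁻¹) ^ a + θBal F.L γ b₀ p₀ n ^ σ := le_add_of_nonneg_right hs
  calc C * θBal F.L γ b₀ p₀ n ^ 2 * (Fintype.card (Site (F.P n) 0) : ℝ) * (((F.L : ℝ) ^ (K - n))⁻¹) ^ a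
      = C * (θBal F.L γ b₀ p₀ n ^ 2 * (((F.L : ℝ) ^ (K - n))⁻¹) ^ a) * (Fintype.card (Site (F.P n) 0) : ℝ) := by ring
    _ ≤ C * (θBal F.L γ b₀ p₀ n ^ 2 * (((F.L : ℝ) ^ (K - n))⁻¹) ^ a + θBal F.L γ b₀ p₀ n ^ σ) * (Fintype.card (Site (F.P n) 0) : ℝ) :=
        mul_le_mul_of_nonneg_right (mul_le_mul_of_nonneg_left hle hC) hN

/-- **W1 + ABSORPTION AT THE WINDOW ⇒ W2′** (constant `2C`): if at every `K` the slack is below the rate term at the window height,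
`θ(⌊K/m⌋)^σ ≤ θ(⌊K/m⌋)²·L^{−a(K−⌊K/m⌋)}`, the slack row gives the pure rate-`a` row at `n = ⌊K/m⌋`.  (The absorption hypothesis is the exponent
condition `a(m−1) < (σ−2)/2` for large `K`, made `K`-uniform by the coupling threshold; see the module docstring for why the REGISTERED quantifier order
cannot use it.) [cite: King1986, Thm 3.4 (3.12)-(3.13) p.657] -/
theorem globalSupRateWindowT_of_slack {b₀ p₀ a C : ℝ} {σ m : ℕ} (hC : 0 ≤ C)
    (habs : ∀ K, θBal F.L γ b₀ p₀ (K / m) ^ σ ≤ θBal F.L γ b₀ p₀ (K / m) ^ 2 * (((F.L : ℝ) ^ (K - K / m))⁻¹) ^ a)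
    (h : GlobalSupSlackT D b₀ p₀ a σ C) : GlobalSupRateWindowT D b₀ p₀ a (2 * C) m := by
  obtain ⟨c, hc⟩ := h
  refine ⟨c, fun K V hV => (hc K (K / m) (Nat.div_le_self K m) V hV).trans ?_⟩
  have hN : (0 : ℝ) ≤ (Fintype.card (Site (F.P (K / m)) 0) : ℝ) := Nat.cast_nonneg _
  have hle : θBal F.L γ b₀ p₀ (K / m) ^ 2 * (((F.L : ℝ) ^ (K - K / m))⁻¹) ^ a + θBal F.L γ b₀ p₀ (K / m) ^ σ ≤
      θBal F.L γ b₀ p₀ (K / m) ^ 2 * (((F.L : ℝ) ^ (K - K / m))⁻¹) ^ a + θBal F.L γ b₀ p₀ (K / m) ^ 2 * (((F.L : ℝ) ^ (K - K / m))⁻¹) ^ a :=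
    add_le_add le_rfl (habs K)
  calc C * (θBal F.L γ b₀ p₀ (K / m) ^ 2 * (((F.L : ℝ) ^ (K - K / m))⁻¹) ^ a + θBal F.L γ b₀ p₀ (K / m) ^ σ) *
        (Fintype.card (Site (F.P (K / m)) 0) : ℝ)
      ≤ C * (θBal F.L γ b₀ p₀ (K / m) ^ 2 * (((F.L : ℝ) ^ (K - K / m))⁻¹) ^ a +
          θBal F.L γ b₀ p₀ (K / m) ^ 2 * (((F.L : ℝ) ^ (K - K / m))⁻¹) ^ a) * (Fintype.card (Site (F.P (K / m)) 0) : ℝ) :=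
        mul_le_mul_of_nonneg_right (mul_le_mul_of_nonneg_left hle hC) hN
    _ = 2 * C * θBal F.L γ b₀ p₀ (K / m) ^ 2 * (Fintype.card (Site (F.P (K / m)) 0) : ℝ) * (((F.L : ℝ) ^ (K - K / m))⁻¹) ^ a := by ring

/-- **W0 ⇒ W2′ for every `m`** (constant unchanged): the registered every-height row trivially contains each window row — recorded so that the three
typings are linearly ordered in strength: W0 ⇒ W1 (with absorption ⇒ W2′), W0 ⇒ W2′. [cite: King1986, Thm 3.4 (3.9) p.656] -/
theorem globalSupRateWindowT_of_rate {b₀ p₀ a C : ℝ} (m : ℕ) (h : GlobalSupRateT D b₀ p₀ a C) : GlobalSupRateWindowT D b₀ p₀ a C m := by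
  obtain ⟨c, hc⟩ := h
  exact ⟨c, fun K V hV => hc K (K / m) (Nat.div_le_self K m) V hV⟩

end Summit.QuantumFields.YangMills.Cruxes.FluctuationComparisonRegPr.Ideate2Slack

end
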